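import Mathlib
import Summits.Ventures.HodgeRepro0.P1LatticeBlockDictConv
import Summits.Ventures.HodgeRepro0.P1LatticeBlockDictBridgeB

/-!
# P1LatticeBlockDictConvBridge — D13's THEOREM A (proofs/P1-FermatLatticeClosure-v1.2.md l.4, DECLARED STATUS l.4789): ONE
BLOCK SET — THE CONVERSE DICTIONARY, THE BRIDGES FOR THE g27 NAMESPACES B–I THROUGH A (pub-hodge-repro0, p1 (g29), 2026-08-30), on
lean/P1LatticeBlockDictConv.lean and the dictionary bridge lean/P1LatticeBlockDictBridgeB.lean.

Supporting artefact in the sense of ROUTE.md R-5 (finite combinatorics / exact arithmetic only; never the discharge of a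
Hodge-theoretic step; record-only).  lean/P1LatticeBlockDict*.lean proved the dictionary g27 → g28: a legitimate g27
`Block`'s multiset at M is an `IsBlock M` multiset.  THIS ARTEFACT proves the converse — every `IsBlock M` multiset is the
multiset at M of a legitimate g27 block: a Hodge 4-multiset or a split Hodge 6-multiset of level M as its own base at the
level M with t = 1 (the g27 Bools `isHodge` / `split6` / `isPrime` FROM the predicates; the split through the first entry by
listing the zero-sum triple first), and Aoki's σ_{p,i} of level M with g := gcd(i, M/p) as the pull-back by g of σ_{p, i/g}
of level M/g (gcd(i/g, (M/g)/p) = 1 and (M/g)/p = (M/p)/g > 2; the σ identity `sigma_pull` with t = 1, k = g, and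
`sigma_isHodge` for the base) — so, for every M ≥ 3 and every g27 namespace, THE TWO LATTICES ARE ONE: the g27 L_M (the
span of the odd vectors of all legitimate `Block`s) EQUALS the g28 L_M (the span of the odd vectors of all `IsBlock M`
multisets), `X_L_eq_spanBlock`; the equalities H_M = L_M of lean/P1LatticeIndexOneEqA–B.lean and
lean/P1LatticeBlockDictEq.lean are literally the same statement.

THE BRIDGE FOR A is in lean/P1LatticeBlockDictConv.lean.  THE BRIDGES FOR B … I, THROUGH A: the nine `Block` structures
have the same fields and the same Bools, so an A-block re-read as an X-block (`A_to_X`) is legitimate at M iff the A-block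
is (`X_ok_of_A`, definitionally) and has the same multiset at M — `X_block_of_isBlock` from `A_block_of_isBlock`, then
`X_spanBlock_le_L` / `X_L_le_spanBlock` / `X_L_eq_spanBlock` as for A.
NOT formalised: claim(·) for the blocks (Shioda 1981 Thm 4.3 / Lefschetz (1,1), Aoki 1987 Thm 2-1 / Thm 1-4); anything
Hodge-theoretic.
Nothing here asserts anything about whether the statement of README §1 has been proved elsewhere.
-/

namespace HodgeRepro0.P1.P1LatticeIndexTwoExact
open Matrix

/-! ## The converse bridge for the namespace `P1LatticeIndexOneB` (the degree file B), through the namespace A -/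

/-- (B) the B-block with the fields of an A-block (the two structures have the same fields and the same Bools) -/
def A_to_B (b : P1LatticeIndexOneA.Block) : P1LatticeIndexOneB.Block := ⟨b.level, b.t, b.kind, b.base, b.p, b.i⟩

/-- (B) legitimacy transfers (the two `Block.ok` are the same Bool, definitionally) -/
theorem B_ok_of_A (M : ℕ) (b : P1LatticeIndexOneA.Block) (h : b.ok M = true) : (A_to_B b).ok M = true := h

/-- (B) THE CONVERSE DICTIONARY, through the namespace A -/
theorem B_block_of_isBlock (M : ℕ) (hM : 3 ≤ M) (m : Multiset ℕ) (hm : IsBlock M m) :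
    ∃ b : P1LatticeIndexOneB.Block, b.ok M = true ∧ m = ((b.ms M : List ℕ) : Multiset ℕ) := by
  obtain ⟨a, ha, hm'⟩ := A_block_of_isBlock M hM m hm
  exact ⟨A_to_B a, B_ok_of_A M a ha, hm'⟩

/-- (B) the g28 L_M ≤ the g27 L_M -/
theorem B_spanBlock_le_L {n : ℕ} (M : ℕ) (hM : 3 ≤ M) :
    Submodule.span ℤ ((oddVec (n := n) M) '' {m | IsBlock M m}) ≤ B_L M n := by
  rw [Submodule.span_le]
  rintro _ ⟨m, hm, rfl⟩
  obtain ⟨b, hb, rfl⟩ := B_block_of_isBlock M hM m hm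
  refine Submodule.subset_span ⟨b.ms M, ⟨b, hb, rfl⟩, ?_⟩
  funext a
  simp [P1LatticeIndexOneB.oddVec, oddVec, Multiset.coe_count]

/-- (B) the g27 L_M ≤ the g28 L_M (the dictionary of lean/P1LatticeBlockDictBridge*.lean) -/
theorem B_L_le_spanBlock {n : ℕ} (M : ℕ) (hM : 0 < M) :
    B_L M n ≤ Submodule.span ℤ ((oddVec (n := n) M) '' {m | IsBlock M m}) := by
  rw [Submodule.span_le]
  rintro _ ⟨ms, ⟨b, hb, rfl⟩, rfl⟩
  refine Submodule.subset_span ⟨((b.ms M : List ℕ) : Multiset ℕ), B_isBlock_of_ok M hM b hb, ?_⟩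
  funext a
  simp [P1LatticeIndexOneB.oddVec, oddVec, Multiset.coe_count]

/-- (B) THE TWO LATTICES ARE ONE: for every M ≥ 3 and n, the g27 L_M equals the g28 L_M -/
theorem B_L_eq_spanBlock {n : ℕ} (M : ℕ) (hM : 3 ≤ M) :
    B_L M n = Submodule.span ℤ ((oddVec (n := n) M) '' {m | IsBlock M m}) :=
  le_antisymm (B_L_le_spanBlock M (by omega)) (B_spanBlock_le_L M hM)

/-! ## The converse bridge for the namespace `P1LatticeIndexOneC` (the degree file C), through the namespace A -/

/-- (C) the C-block with the fields of an A-block (the two structures have the same fields and the same Bools) -/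
def A_to_C (b : P1LatticeIndexOneA.Block) : P1LatticeIndexOneC.Block := ⟨b.level, b.t, b.kind, b.base, b.p, b.i⟩

/-- (C) legitimacy transfers (the two `Block.ok` are the same Bool, definitionally) -/
theorem C_ok_of_A (M : ℕ) (b : P1LatticeIndexOneA.Block) (h : b.ok M = true) : (A_to_C b).ok M = true := h

/-- (C) THE CONVERSE DICTIONARY, through the namespace A -/
theorem C_block_of_isBlock (M : ℕ) (hM : 3 ≤ M) (m : Multiset ℕ) (hm : IsBlock M m) :
    ∃ b : P1LatticeIndexOneC.Block, b.ok M = true ∧ m = ((b.ms M : List ℕ) : Multiset ℕ) := by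
  obtain ⟨a, ha, hm'⟩ := A_block_of_isBlock M hM m hm
  exact ⟨A_to_C a, C_ok_of_A M a ha, hm'⟩

/-- (C) the g28 L_M ≤ the g27 L_M -/
theorem C_spanBlock_le_L {n : ℕ} (M : ℕ) (hM : 3 ≤ M) :
    Submodule.span ℤ ((oddVec (n := n) M) '' {m | IsBlock M m}) ≤ C_L M n := by
  rw [Submodule.span_le]
  rintro _ ⟨m, hm, rfl⟩
  obtain ⟨b, hb, rfl⟩ := C_block_of_isBlock M hM m hm
  refine Submodule.subset_span ⟨b.ms M, ⟨b, hb, rfl⟩, ?_⟩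
  funext a
  simp [P1LatticeIndexOneC.oddVec, oddVec, Multiset.coe_count]

/-- (C) the g27 L_M ≤ the g28 L_M (the dictionary of lean/P1LatticeBlockDictBridge*.lean) -/
theorem C_L_le_spanBlock {n : ℕ} (M : ℕ) (hM : 0 < M) :
    C_L M n ≤ Submodule.span ℤ ((oddVec (n := n) M) '' {m | IsBlock M m}) := by
  rw [Submodule.span_le]
  rintro _ ⟨ms, ⟨b, hb, rfl⟩, rfl⟩
  refine Submodule.subset_span ⟨((b.ms M : List ℕ) : Multiset ℕ), C_isBlock_of_ok M hM b hb, ?_⟩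
  funext a
  simp [P1LatticeIndexOneC.oddVec, oddVec, Multiset.coe_count]

/-- (C) THE TWO LATTICES ARE ONE: for every M ≥ 3 and n, the g27 L_M equals the g28 L_M -/
theorem C_L_eq_spanBlock {n : ℕ} (M : ℕ) (hM : 3 ≤ M) :
    C_L M n = Submodule.span ℤ ((oddVec (n := n) M) '' {m | IsBlock M m}) :=
  le_antisymm (C_L_le_spanBlock M (by omega)) (C_spanBlock_le_L M hM)

/-! ## The converse bridge for the namespace `P1LatticeIndexOneD` (the degree file D), through the namespace A -/

/-- (D) the D-block with the fields of an A-block (the two structures have the same fields and the same Bools) -/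
def A_to_D (b : P1LatticeIndexOneA.Block) : P1LatticeIndexOneD.Block := ⟨b.level, b.t, b.kind, b.base, b.p, b.i⟩

/-- (D) legitimacy transfers (the two `Block.ok` are the same Bool, definitionally) -/
theorem D_ok_of_A (M : ℕ) (b : P1LatticeIndexOneA.Block) (h : b.ok M = true) : (A_to_D b).ok M = true := h

/-- (D) THE CONVERSE DICTIONARY, through the namespace A -/
theorem D_block_of_isBlock (M : ℕ) (hM : 3 ≤ M) (m : Multiset ℕ) (hm : IsBlock M m) :
    ∃ b : P1LatticeIndexOneD.Block, b.ok M = true ∧ m = ((b.ms M : List ℕ) : Multiset ℕ) := by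
  obtain ⟨a, ha, hm'⟩ := A_block_of_isBlock M hM m hm
  exact ⟨A_to_D a, D_ok_of_A M a ha, hm'⟩

/-- (D) the g28 L_M ≤ the g27 L_M -/
theorem D_spanBlock_le_L {n : ℕ} (M : ℕ) (hM : 3 ≤ M) :
    Submodule.span ℤ ((oddVec (n := n) M) '' {m | IsBlock M m}) ≤ D_L M n := by
  rw [Submodule.span_le]
  rintro _ ⟨m, hm, rfl⟩
  obtain ⟨b, hb, rfl⟩ := D_block_of_isBlock M hM m hm
  refine Submodule.subset_span ⟨b.ms M, ⟨b, hb, rfl⟩, ?_⟩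
  funext a
  simp [P1LatticeIndexOneD.oddVec, oddVec, Multiset.coe_count]

/-- (D) the g27 L_M ≤ the g28 L_M (the dictionary of lean/P1LatticeBlockDictBridge*.lean) -/
theorem D_L_le_spanBlock {n : ℕ} (M : ℕ) (hM : 0 < M) :
    D_L M n ≤ Submodule.span ℤ ((oddVec (n := n) M) '' {m | IsBlock M m}) := by
  rw [Submodule.span_le]
  rintro _ ⟨ms, ⟨b, hb, rfl⟩, rfl⟩
  refine Submodule.subset_span ⟨((b.ms M : List ℕ) : Multiset ℕ), D_isBlock_of_ok M hM b hb, ?_⟩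
  funext a
  simp [P1LatticeIndexOneD.oddVec, oddVec, Multiset.coe_count]

/-- (D) THE TWO LATTICES ARE ONE: for every M ≥ 3 and n, the g27 L_M equals the g28 L_M -/
theorem D_L_eq_spanBlock {n : ℕ} (M : ℕ) (hM : 3 ≤ M) :
    D_L M n = Submodule.span ℤ ((oddVec (n := n) M) '' {m | IsBlock M m}) :=
  le_antisymm (D_L_le_spanBlock M (by omega)) (D_spanBlock_le_L M hM)

/-! ## The converse bridge for the namespace `P1LatticeIndexOneE` (the degree file E), through the namespace A -/

/-- (E) the E-block with the fields of an A-block (the two structures have the same fields and the same Bools) -/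
def A_to_E (b : P1LatticeIndexOneA.Block) : P1LatticeIndexOneE.Block := ⟨b.level, b.t, b.kind, b.base, b.p, b.i⟩

/-- (E) legitimacy transfers (the two `Block.ok` are the same Bool, definitionally) -/
theorem E_ok_of_A (M : ℕ) (b : P1LatticeIndexOneA.Block) (h : b.ok M = true) : (A_to_E b).ok M = true := h

/-- (E) THE CONVERSE DICTIONARY, through the namespace A -/
theorem E_block_of_isBlock (M : ℕ) (hM : 3 ≤ M) (m : Multiset ℕ) (hm : IsBlock M m) :
    ∃ b : P1LatticeIndexOneE.Block, b.ok M = true ∧ m = ((b.ms M : List ℕ) : Multiset ℕ) := by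
  obtain ⟨a, ha, hm'⟩ := A_block_of_isBlock M hM m hm
  exact ⟨A_to_E a, E_ok_of_A M a ha, hm'⟩

/-- (E) the g28 L_M ≤ the g27 L_M -/
theorem E_spanBlock_le_L {n : ℕ} (M : ℕ) (hM : 3 ≤ M) :
    Submodule.span ℤ ((oddVec (n := n) M) '' {m | IsBlock M m}) ≤ E_L M n := by
  rw [Submodule.span_le]
  rintro _ ⟨m, hm, rfl⟩
  obtain ⟨b, hb, rfl⟩ := E_block_of_isBlock M hM m hm
  refine Submodule.subset_span ⟨b.ms M, ⟨b, hb, rfl⟩, ?_⟩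
  funext a
  simp [P1LatticeIndexOneE.oddVec, oddVec, Multiset.coe_count]

/-- (E) the g27 L_M ≤ the g28 L_M (the dictionary of lean/P1LatticeBlockDictBridge*.lean) -/
theorem E_L_le_spanBlock {n : ℕ} (M : ℕ) (hM : 0 < M) :
    E_L M n ≤ Submodule.span ℤ ((oddVec (n := n) M) '' {m | IsBlock M m}) := by
  rw [Submodule.span_le]
  rintro _ ⟨ms, ⟨b, hb, rfl⟩, rfl⟩
  refine Submodule.subset_span ⟨((b.ms M : List ℕ) : Multiset ℕ), E_isBlock_of_ok M hM b hb, ?_⟩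
  funext a
  simp [P1LatticeIndexOneE.oddVec, oddVec, Multiset.coe_count]

/-- (E) THE TWO LATTICES ARE ONE: for every M ≥ 3 and n, the g27 L_M equals the g28 L_M -/
theorem E_L_eq_spanBlock {n : ℕ} (M : ℕ) (hM : 3 ≤ M) :
    E_L M n = Submodule.span ℤ ((oddVec (n := n) M) '' {m | IsBlock M m}) :=
  le_antisymm (E_L_le_spanBlock M (by omega)) (E_spanBlock_le_L M hM)

/-! ## The converse bridge for the namespace `P1LatticeIndexOneF` (the degree file F), through the namespace A -/

/-- (F) the F-block with the fields of an A-block (the two structures have the same fields and the same Bools) -/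
def A_to_F (b : P1LatticeIndexOneA.Block) : P1LatticeIndexOneF.Block := ⟨b.level, b.t, b.kind, b.base, b.p, b.i⟩

/-- (F) legitimacy transfers (the two `Block.ok` are the same Bool, definitionally) -/
theorem F_ok_of_A (M : ℕ) (b : P1LatticeIndexOneA.Block) (h : b.ok M = true) : (A_to_F b).ok M = true := h

/-- (F) THE CONVERSE DICTIONARY, through the namespace A -/
theorem F_block_of_isBlock (M : ℕ) (hM : 3 ≤ M) (m : Multiset ℕ) (hm : IsBlock M m) :
    ∃ b : P1LatticeIndexOneF.Block, b.ok M = true ∧ m = ((b.ms M : List ℕ) : Multiset ℕ) := by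
  obtain ⟨a, ha, hm'⟩ := A_block_of_isBlock M hM m hm
  exact ⟨A_to_F a, F_ok_of_A M a ha, hm'⟩

/-- (F) the g28 L_M ≤ the g27 L_M -/
theorem F_spanBlock_le_L {n : ℕ} (M : ℕ) (hM : 3 ≤ M) :
    Submodule.span ℤ ((oddVec (n := n) M) '' {m | IsBlock M m}) ≤ F_L M n := by
  rw [Submodule.span_le]
  rintro _ ⟨m, hm, rfl⟩
  obtain ⟨b, hb, rfl⟩ := F_block_of_isBlock M hM m hm
  refine Submodule.subset_span ⟨b.ms M, ⟨b, hb, rfl⟩, ?_⟩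
  funext a
  simp [P1LatticeIndexOneF.oddVec, oddVec, Multiset.coe_count]

/-- (F) the g27 L_M ≤ the g28 L_M (the dictionary of lean/P1LatticeBlockDictBridge*.lean) -/
theorem F_L_le_spanBlock {n : ℕ} (M : ℕ) (hM : 0 < M) :
    F_L M n ≤ Submodule.span ℤ ((oddVec (n := n) M) '' {m | IsBlock M m}) := by
  rw [Submodule.span_le]
  rintro _ ⟨ms, ⟨b, hb, rfl⟩, rfl⟩
  refine Submodule.subset_span ⟨((b.ms M : List ℕ) : Multiset ℕ), F_isBlock_of_ok M hM b hb, ?_⟩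
  funext a
  simp [P1LatticeIndexOneF.oddVec, oddVec, Multiset.coe_count]

/-- (F) THE TWO LATTICES ARE ONE: for every M ≥ 3 and n, the g27 L_M equals the g28 L_M -/
theorem F_L_eq_spanBlock {n : ℕ} (M : ℕ) (hM : 3 ≤ M) :
    F_L M n = Submodule.span ℤ ((oddVec (n := n) M) '' {m | IsBlock M m}) :=
  le_antisymm (F_L_le_spanBlock M (by omega)) (F_spanBlock_le_L M hM)

/-! ## The converse bridge for the namespace `P1LatticeIndexOneG` (the degree file G), through the namespace A -/

/-- (G) the G-block with the fields of an A-block (the two structures have the same fields and the same Bools) -/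
def A_to_G (b : P1LatticeIndexOneA.Block) : P1LatticeIndexOneG.Block := ⟨b.level, b.t, b.kind, b.base, b.p, b.i⟩

/-- (G) legitimacy transfers (the two `Block.ok` are the same Bool, definitionally) -/
theorem G_ok_of_A (M : ℕ) (b : P1LatticeIndexOneA.Block) (h : b.ok M = true) : (A_to_G b).ok M = true := h

/-- (G) THE CONVERSE DICTIONARY, through the namespace A -/
theorem G_block_of_isBlock (M : ℕ) (hM : 3 ≤ M) (m : Multiset ℕ) (hm : IsBlock M m) :
    ∃ b : P1LatticeIndexOneG.Block, b.ok M = true ∧ m = ((b.ms M : List ℕ) : Multiset ℕ) := by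
  obtain ⟨a, ha, hm'⟩ := A_block_of_isBlock M hM m hm
  exact ⟨A_to_G a, G_ok_of_A M a ha, hm'⟩

/-- (G) the g28 L_M ≤ the g27 L_M -/
theorem G_spanBlock_le_L {n : ℕ} (M : ℕ) (hM : 3 ≤ M) :
    Submodule.span ℤ ((oddVec (n := n) M) '' {m | IsBlock M m}) ≤ G_L M n := by
  rw [Submodule.span_le]
  rintro _ ⟨m, hm, rfl⟩
  obtain ⟨b, hb, rfl⟩ := G_block_of_isBlock M hM m hm
  refine Submodule.subset_span ⟨b.ms M, ⟨b, hb, rfl⟩, ?_⟩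
  funext a
  simp [P1LatticeIndexOneG.oddVec, oddVec, Multiset.coe_count]

/-- (G) the g27 L_M ≤ the g28 L_M (the dictionary of lean/P1LatticeBlockDictBridge*.lean) -/
theorem G_L_le_spanBlock {n : ℕ} (M : ℕ) (hM : 0 < M) :
    G_L M n ≤ Submodule.span ℤ ((oddVec (n := n) M) '' {m | IsBlock M m}) := by
  rw [Submodule.span_le]
  rintro _ ⟨ms, ⟨b, hb, rfl⟩, rfl⟩
  refine Submodule.subset_span ⟨((b.ms M : List ℕ) : Multiset ℕ), G_isBlock_of_ok M hM b hb, ?_⟩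
  funext a
  simp [P1LatticeIndexOneG.oddVec, oddVec, Multiset.coe_count]

/-- (G) THE TWO LATTICES ARE ONE: for every M ≥ 3 and n, the g27 L_M equals the g28 L_M -/
theorem G_L_eq_spanBlock {n : ℕ} (M : ℕ) (hM : 3 ≤ M) :
    G_L M n = Submodule.span ℤ ((oddVec (n := n) M) '' {m | IsBlock M m}) :=
  le_antisymm (G_L_le_spanBlock M (by omega)) (G_spanBlock_le_L M hM)

/-! ## The converse bridge for the namespace `P1LatticeIndexOneH` (the degree file H), through the namespace A -/

/-- (H) the H-block with the fields of an A-block (the two structures have the same fields and the same Bools) -/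
def A_to_H (b : P1LatticeIndexOneA.Block) : P1LatticeIndexOneH.Block := ⟨b.level, b.t, b.kind, b.base, b.p, b.i⟩

/-- (H) legitimacy transfers (the two `Block.ok` are the same Bool, definitionally) -/
theorem H_ok_of_A (M : ℕ) (b : P1LatticeIndexOneA.Block) (h : b.ok M = true) : (A_to_H b).ok M = true := h

/-- (H) THE CONVERSE DICTIONARY, through the namespace A -/
theorem H_block_of_isBlock (M : ℕ) (hM : 3 ≤ M) (m : Multiset ℕ) (hm : IsBlock M m) :
    ∃ b : P1LatticeIndexOneH.Block, b.ok M = true ∧ m = ((b.ms M : List ℕ) : Multiset ℕ) := by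
  obtain ⟨a, ha, hm'⟩ := A_block_of_isBlock M hM m hm
  exact ⟨A_to_H a, H_ok_of_A M a ha, hm'⟩

/-- (H) the g28 L_M ≤ the g27 L_M -/
theorem H_spanBlock_le_L {n : ℕ} (M : ℕ) (hM : 3 ≤ M) :
    Submodule.span ℤ ((oddVec (n := n) M) '' {m | IsBlock M m}) ≤ H_L M n := by
  rw [Submodule.span_le]
  rintro _ ⟨m, hm, rfl⟩
  obtain ⟨b, hb, rfl⟩ := H_block_of_isBlock M hM m hm
  refine Submodule.subset_span ⟨b.ms M, ⟨b, hb, rfl⟩, ?_⟩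
  funext a
  simp [P1LatticeIndexOneH.oddVec, oddVec, Multiset.coe_count]

/-- (H) the g27 L_M ≤ the g28 L_M (the dictionary of lean/P1LatticeBlockDictBridge*.lean) -/
theorem H_L_le_spanBlock {n : ℕ} (M : ℕ) (hM : 0 < M) :
    H_L M n ≤ Submodule.span ℤ ((oddVec (n := n) M) '' {m | IsBlock M m}) := by
  rw [Submodule.span_le]
  rintro _ ⟨ms, ⟨b, hb, rfl⟩, rfl⟩
  refine Submodule.subset_span ⟨((b.ms M : List ℕ) : Multiset ℕ), H_isBlock_of_ok M hM b hb, ?_⟩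
  funext a
  simp [P1LatticeIndexOneH.oddVec, oddVec, Multiset.coe_count]

/-- (H) THE TWO LATTICES ARE ONE: for every M ≥ 3 and n, the g27 L_M equals the g28 L_M -/
theorem H_L_eq_spanBlock {n : ℕ} (M : ℕ) (hM : 3 ≤ M) :
    H_L M n = Submodule.span ℤ ((oddVec (n := n) M) '' {m | IsBlock M m}) :=
  le_antisymm (H_L_le_spanBlock M (by omega)) (H_spanBlock_le_L M hM)

/-! ## The converse bridge for the namespace `P1LatticeIndexOneI` (the degree file I), through the namespace A -/

/-- (I) the I-block with the fields of an A-block (the two structures have the same fields and the same Bools) -/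
def A_to_I (b : P1LatticeIndexOneA.Block) : P1LatticeIndexOneI.Block := ⟨b.level, b.t, b.kind, b.base, b.p, b.i⟩

/-- (I) legitimacy transfers (the two `Block.ok` are the same Bool, definitionally) -/
theorem I_ok_of_A (M : ℕ) (b : P1LatticeIndexOneA.Block) (h : b.ok M = true) : (A_to_I b).ok M = true := h

/-- (I) THE CONVERSE DICTIONARY, through the namespace A -/
theorem I_block_of_isBlock (M : ℕ) (hM : 3 ≤ M) (m : Multiset ℕ) (hm : IsBlock M m) :
    ∃ b : P1LatticeIndexOneI.Block, b.ok M = true ∧ m = ((b.ms M : List ℕ) : Multiset ℕ) := by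
  obtain ⟨a, ha, hm'⟩ := A_block_of_isBlock M hM m hm
  exact ⟨A_to_I a, I_ok_of_A M a ha, hm'⟩

/-- (I) the g28 L_M ≤ the g27 L_M -/
theorem I_spanBlock_le_L {n : ℕ} (M : ℕ) (hM : 3 ≤ M) :
    Submodule.span ℤ ((oddVec (n := n) M) '' {m | IsBlock M m}) ≤ I_L M n := by
  rw [Submodule.span_le]
  rintro _ ⟨m, hm, rfl⟩
  obtain ⟨b, hb, rfl⟩ := I_block_of_isBlock M hM m hm
  refine Submodule.subset_span ⟨b.ms M, ⟨b, hb, rfl⟩, ?_⟩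
  funext a
  simp [P1LatticeIndexOneI.oddVec, oddVec, Multiset.coe_count]

/-- (I) the g27 L_M ≤ the g28 L_M (the dictionary of lean/P1LatticeBlockDictBridge*.lean) -/
theorem I_L_le_spanBlock {n : ℕ} (M : ℕ) (hM : 0 < M) :
    I_L M n ≤ Submodule.span ℤ ((oddVec (n := n) M) '' {m | IsBlock M m}) := by
  rw [Submodule.span_le]
  rintro _ ⟨ms, ⟨b, hb, rfl⟩, rfl⟩
  refine Submodule.subset_span ⟨((b.ms M : List ℕ) : Multiset ℕ), I_isBlock_of_ok M hM b hb, ?_⟩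
  funext a
  simp [P1LatticeIndexOneI.oddVec, oddVec, Multiset.coe_count]

/-- (I) THE TWO LATTICES ARE ONE: for every M ≥ 3 and n, the g27 L_M equals the g28 L_M -/
theorem I_L_eq_spanBlock {n : ℕ} (M : ℕ) (hM : 3 ≤ M) :
    I_L M n = Submodule.span ℤ ((oddVec (n := n) M) '' {m | IsBlock M m}) :=
  le_antisymm (I_L_le_spanBlock M (by omega)) (I_spanBlock_le_L M hM)

end HodgeRepro0.P1.P1LatticeIndexTwoExact
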